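import Summits.CriticalPhenomena.PercolationContinuityZ3.Theorems.SahiIsingGibbsStates
import Summits.CriticalPhenomena.PercolationContinuityZ3.Theorems.SahiIsingCumulations
import Literature.Probability.LatticeModels.TailTrivialGibbs

/-!
# Every tail-trivial (extremal) Ising Gibbs state is box-TP₂: Sahi positivity given `C_n`, two free slots without

Support file of the Sahi cell (`prim-sahi`, typer seat, generation 13; `--supports stmt-CriticalPhenomena-4575`).
Theorems only (no definitions, no named facts, no sorries).  Fourth file of the generation-13 Ising series
(`SahiIsingBoxTP2`, `SahiIsingGibbsStates`, `SahiIsingCumulations`).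

Georgii–Higuchi (2000, §2): "extremal Gibbs measures have positive correlations"; the tree proves this for the
nearest-neighbour Ising model on `ℤ^d` in the form `isingGibbs_integral_mul_ge_of_isTailTrivial` (tail-trivial
`μ ∈ 𝒢(β,h)`, `β ≥ 0`), from Georgii's Thm. 7.12 in subsequence form
(`IsGibbsMeasure.exists_strictMono_ae_tendsto_integral_spec`: the finite-volume kernels `γ_Λ(·|ω)` converge to `μ` on
a bounded measurable observable along a subsequence, for `μ`-a.e. `ω`).  Here the full lattice structure:

* `isBoxTP2_of_faces` — box-TP₂ on `{−1,+1}^ι` follows from the inequality for the four FACE boxes over every finite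
  window (continuity from above along an exhaustion; the half of `isBoxTP2_of_tendsto_local` that needs no limit).
* `isBoxTP2_of_isTailTrivial` — **every tail-trivial `μ ∈ 𝒢(β,h)` (`β ≥ 0`, any `h`, any `d`) is box-TP₂**: for the
  four faces, refine an exhaustion four times (`exists_refine_tendsto_integral_spec`) to a subsequence along which
  all four kernel masses converge for a.e. boundary condition `ω`; fix one such `ω`; the kernels
  `γ_Λ(·|ω) = μ^ω_{Λ;β,h}` are box-TP₂ (`isBoxTP2_isingMeasure`), and the face corners are paddings, so the
  finite-volume inequality passes to the limit.  This covers the plus and minus states again, and also every other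
  extremal state (e.g. Dobrushin's non-translation-invariant states of `ℤ³`), with no convergence-of-correlations
  input.
* Consequences: `msahiE_nonneg_of_isTailTrivial` (+ `_antitone`, `_of_sahiConjecture`) — **given `C_n`, every
  tail-trivial Ising Gibbs state on `ℤ^d` (`d ≥ 1`) has `E_n(f_0,…,f_{n−1}) ≥ 0` for all measurable nonnegative
  monotone functionals**; UNCONDITIONALLY `msahiE_nonneg_plusSpins_offTwo_of_isTailTrivial` (Sahi's Theorem 2 with
  two free local slots, every `n`) and the displayed `sahiE3_plusSpins_nonneg_of_isTailTrivial`.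

No sorries, no new axioms.
-/

noncomputable section

namespace Summit.CriticalPhenomena.PercolationContinuityZ3.Theorems.SahiBoxTP2

open MeasureTheory ProbabilityTheory Set Filter Topology Function Literature.Combinatorics.Sahi2008
open Literature.Probability.LatticeModels
open scoped ENNReal

/-! ### Box-TP₂ from the face inequalities -/

section Faces

variable {ι : Type*} [Countable ι] [DecidableEq ι]

/-- **Box-TP₂ follows from the inequality for the face boxes over every finite window** (the faces of a box decrease
to the box along an exhaustion of `ι`; continuity from above). [this work] -/
theorem isBoxTP2_of_faces (μ : Measure (ι → ℤˣ)) [IsFiniteMeasure μ]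
    (hface : ∀ (J : Finset ι) (a b a' b' : ι → ℤˣ),
      μ (Icc (J.piecewise a (-1)) (J.piecewise b 1)) * μ (Icc (J.piecewise a' (-1)) (J.piecewise b' 1)) ≤
        μ (Icc (J.piecewise (a ⊓ a') (-1)) (J.piecewise (b ⊓ b') 1)) *
          μ (Icc (J.piecewise (a ⊔ a') (-1)) (J.piecewise (b ⊔ b') 1))) :
    IsBoxTP2 μ := by
  obtain ⟨J, hJm, hJ⟩ := exists_finset_exhaustion (ι := ι)
  have hfin : ∀ s : Set (ι → ℤˣ), μ s ≠ ∞ := fun s => measure_ne_top μ s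
  have hlim : ∀ p q : ι → ℤˣ,
      Tendsto (fun m => μ (Icc ((J m).piecewise p (-1)) ((J m).piecewise q 1))) atTop (𝓝 (μ (Icc p q))) := by
    intro p q
    have h := tendsto_measure_iInter_atTop (μ := μ)
      (fun m => (measurableSet_Icc_spinConfig ((J m).piecewise p (-1)) ((J m).piecewise q 1)).nullMeasurableSet)
      (antitone_Icc_piecewise hJm p q) ⟨0, hfin _⟩
    rw [iInter_Icc_piecewise hJ p q] at h
    exact h
  intro a b a' b'
  exact le_of_tendsto_of_tendsto'
    (ENNReal.Tendsto.mul (hlim a b) (Or.inr (hfin _)) (hlim a' b') (Or.inr (hfin _)))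
    (ENNReal.Tendsto.mul (hlim (a ⊓ a') (b ⊓ b')) (Or.inr (hfin _)) (hlim (a ⊔ a') (b ⊔ b'))
      (Or.inr (hfin _))) fun m => hface (J m) a b a' b'

/-- The indicator of a face box is measurable and bounded by `1`. [folklore] -/
theorem measurable_indicator_Icc_piecewise (J : Finset ι) (a b : ι → ℤˣ) :
    Measurable ((Icc (J.piecewise a (-1)) (J.piecewise b 1)).indicator (1 : (ι → ℤˣ) → ℝ)) ∧
      ∀ σ, |(Icc (J.piecewise a (-1)) (J.piecewise b 1)).indicator (1 : (ι → ℤˣ) → ℝ) σ| ≤ 1 := by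
  classical
  refine ⟨measurable_const.indicator (measurableSet_Icc_spinConfig _ _), fun σ => ?_⟩
  simp only [Set.indicator_apply, Pi.one_apply]
  split_ifs <;> simp

end Faces

/-! ### Refining an exhaustion along Georgii's subsequence -/

section Refine

variable {V S : Type*} [MeasurableSpace S] {γ : Specification V S}

/-- A subsequence of an increasing exhausting sequence of volumes is increasing and exhausting. [folklore] -/
theorem exhaustion_comp_strictMono {Λ : ℕ → Finset V} (hΛmono : Monotone Λ) (hΛex : ∀ Δ : Finset V, ∃ n, Δ ⊆ Λ n)
    {φ : ℕ → ℕ} (hφ : StrictMono φ) : Monotone (Λ ∘ φ) ∧ ∀ Δ : Finset V, ∃ n, Δ ⊆ (Λ ∘ φ) n :=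
  ⟨hΛmono.comp hφ.monotone, fun Δ => by
    obtain ⟨n, hn⟩ := hΛex Δ
    exact ⟨n, hn.trans (hΛmono (hφ.id_le n))⟩⟩

/-- **One refinement step** (Georgii 2011, Thm. 7.12 via `IsGibbsMeasure.exists_strictMono_ae_tendsto_integral_spec`):
along a subsequence of the given exhaustion — again an increasing exhausting sequence — the finite-volume expectations
of the bounded measurable `f` converge to `∫ f dμ` for `μ`-a.e. boundary condition. [cite: Georgii2011, Thm. 7.12] -/
theorem exists_refine_tendsto_integral_spec (hγ : IsSpecification γ) {μ : Measure (V → S)}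
    (hμ : IsGibbsMeasure γ μ) (hμt : IsTailTrivial μ) {Λ : ℕ → Finset V} (hΛmono : Monotone Λ)
    (hΛex : ∀ Δ : Finset V, ∃ n, Δ ⊆ Λ n) {f : (V → S) → ℝ} (hfm : Measurable f) {C : ℝ}
    (hfC : ∀ σ, |f σ| ≤ C) :
    ∃ φ : ℕ → ℕ, StrictMono φ ∧ Monotone (Λ ∘ φ) ∧ (∀ Δ : Finset V, ∃ n, Δ ⊆ (Λ ∘ φ) n) ∧
      ∀ᵐ ω ∂μ, Tendsto (fun j => ∫ σ, f σ ∂(γ ((Λ ∘ φ) j) ω)) atTop (𝓝 (∫ σ, f σ ∂μ)) := by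
  obtain ⟨φ, hφ, hlim⟩ := hμ.exists_strictMono_ae_tendsto_integral_spec hγ hμt hΛmono hΛex hfm hfC
  exact ⟨φ, hφ, (exhaustion_comp_strictMono hΛmono hΛex hφ).1, (exhaustion_comp_strictMono hΛmono hΛex hφ).2, hlim⟩

end Refine

/-! ### Tail-trivial Ising Gibbs states are box-TP₂ -/

section TailTrivial

variable {d : ℕ} {β h : ℝ}

/-- From the convergence of the kernel expectations of the indicator of a measurable set to the convergence of the
kernel masses in `ℝ≥0∞`. [folklore] -/
theorem tendsto_measure_of_tendsto_integral_indicator {Ω : Type*} [MeasurableSpace Ω] (ν : ℕ → Measure Ω)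
    [∀ j, IsProbabilityMeasure (ν j)] (μ : Measure Ω) [IsProbabilityMeasure μ] {C : Set Ω} (hC : MeasurableSet C)
    (h : Tendsto (fun j => ∫ σ, C.indicator (1 : Ω → ℝ) σ ∂(ν j)) atTop (𝓝 (∫ σ, C.indicator (1 : Ω → ℝ) σ ∂μ))) :
    Tendsto (fun j => ν j C) atTop (𝓝 (μ C)) := by
  have e1 : (fun j => ∫ σ, C.indicator (1 : Ω → ℝ) σ ∂(ν j)) = fun j => (ν j).real C :=
    funext fun j => integral_indicator_one hC
  rw [e1, integral_indicator_one hC] at h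
  have h2 := ENNReal.tendsto_ofReal h
  have e2 : (fun j => ENNReal.ofReal ((ν j).real C)) = fun j => ν j C :=
    funext fun j => ofReal_measureReal (measure_ne_top _ _)
  rwa [e2, ofReal_measureReal (measure_ne_top _ _)] at h2

/-- **EVERY TAIL-TRIVIAL (EXTREMAL) ISING GIBBS STATE IS BOX-TP₂** (`β ≥ 0`, any field `h`, any `d`): for a
tail-trivial `μ ∈ 𝒢(β,h)` on `{−1,+1}^{ℤ^d}` and all order boxes,
`μ[a,b] μ[a',b'] ≤ μ[a ∧ a', b ∧ b'] μ[a ∨ a', b ∨ b']`.  Proof: for the four faces over a finite window, refine an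
exhaustion four times so that the kernel masses `γ_{Λ_j}(F_k|ω)` of all four faces converge to `μ(F_k)` for a.e.
`ω` (Georgii's Thm. 7.12); for one such `ω` the kernels are the fixed-boundary finite-volume measures, box-TP₂ by
`isBoxTP2_isingMeasure`, and the face corners are paddings (`piecewise_inf`, `piecewise_sup`).
[this work; cite: Georgii2011, Thm. 7.12; GeorgiiHiguchi2000, §2 p. 3] -/
theorem isBoxTP2_of_isTailTrivial (hβ : 0 ≤ β) {μ : Measure (SpinConfig (Site d))}
    (hμ : μ ∈ isingGibbsMeasures d β h) (hμt : IsTailTrivial μ) : IsBoxTP2 μ := by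
  classical
  have hγ : IsSpecification (isingSpecification (zdGraph d) β h) :=
    isSpecification_isingSpecification_zd_holds d β h
  have hμG : IsGibbsMeasure (isingSpecification (zdGraph d) β h) μ := hμ
  haveI := hμG.isProbabilityMeasure
  refine isBoxTP2_of_faces μ fun J a b a' b' => ?_
  -- the four faces
  set F : SpinConfig (Site d) → SpinConfig (Site d) → Set (SpinConfig (Site d)) :=
    fun p q => Icc (J.piecewise p (-1)) (J.piecewise q 1) with hF
  have hFm : ∀ p q, MeasurableSet (F p q) := fun p q => measurableSet_Icc_spinConfig _ _
  have hI : ∀ p q, Measurable ((F p q).indicator (1 : SpinConfig (Site d) → ℝ)) ∧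
      ∀ σ, |(F p q).indicator (1 : SpinConfig (Site d) → ℝ) σ| ≤ 1 := fun p q =>
    measurable_indicator_Icc_piecewise J p q
  -- four refinements of an exhaustion
  obtain ⟨Λ₀, hΛ₀m, hΛ₀e⟩ := exists_monotone_finset_exhaustion (Site d)
  obtain ⟨φ₁, hφ₁, hΛ₁m, hΛ₁e, h₁⟩ := exists_refine_tendsto_integral_spec hγ hμG hμt hΛ₀m hΛ₀e (hI a b).1 (hI a b).2
  obtain ⟨φ₂, hφ₂, hΛ₂m, hΛ₂e, h₂⟩ :=
    exists_refine_tendsto_integral_spec hγ hμG hμt hΛ₁m hΛ₁e (hI a' b').1 (hI a' b').2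
  obtain ⟨φ₃, hφ₃, hΛ₃m, hΛ₃e, h₃⟩ :=
    exists_refine_tendsto_integral_spec hγ hμG hμt hΛ₂m hΛ₂e (hI (a ⊓ a') (b ⊓ b')).1 (hI (a ⊓ a') (b ⊓ b')).2
  obtain ⟨φ₄, hφ₄, -, -, h₄⟩ :=
    exists_refine_tendsto_integral_spec hγ hμG hμt hΛ₃m hΛ₃e (hI (a ⊔ a') (b ⊔ b')).1 (hI (a ⊔ a') (b ⊔ b')).2
  set Λ : ℕ → Finset (Site d) := Λ₀ ∘ φ₁ ∘ φ₂ ∘ φ₃ ∘ φ₄ with hΛ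
  -- all four converge along `Λ`, for a.e. `ω`
  have h₁' : ∀ᵐ ω ∂μ, Tendsto (fun j => ∫ σ, (F a b).indicator (1 : SpinConfig (Site d) → ℝ) σ
      ∂(isingSpecification (zdGraph d) β h (Λ j) ω)) atTop (𝓝 (∫ σ, (F a b).indicator 1 σ ∂μ)) := by
    filter_upwards [h₁] with ω hω
    exact hω.comp ((hφ₂.comp (hφ₃.comp hφ₄)).tendsto_atTop)
  have h₂' : ∀ᵐ ω ∂μ, Tendsto (fun j => ∫ σ, (F a' b').indicator (1 : SpinConfig (Site d) → ℝ) σ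
      ∂(isingSpecification (zdGraph d) β h (Λ j) ω)) atTop (𝓝 (∫ σ, (F a' b').indicator 1 σ ∂μ)) := by
    filter_upwards [h₂] with ω hω
    exact hω.comp ((hφ₃.comp hφ₄).tendsto_atTop)
  have h₃' : ∀ᵐ ω ∂μ, Tendsto (fun j => ∫ σ, (F (a ⊓ a') (b ⊓ b')).indicator (1 : SpinConfig (Site d) → ℝ) σ
      ∂(isingSpecification (zdGraph d) β h (Λ j) ω)) atTop
      (𝓝 (∫ σ, (F (a ⊓ a') (b ⊓ b')).indicator 1 σ ∂μ)) := by
    filter_upwards [h₃] with ω hω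
    exact hω.comp hφ₄.tendsto_atTop
  have h₄' : ∀ᵐ ω ∂μ, Tendsto (fun j => ∫ σ, (F (a ⊔ a') (b ⊔ b')).indicator (1 : SpinConfig (Site d) → ℝ) σ
      ∂(isingSpecification (zdGraph d) β h (Λ j) ω)) atTop
      (𝓝 (∫ σ, (F (a ⊔ a') (b ⊔ b')).indicator 1 σ ∂μ)) := h₄
  -- fix one good boundary condition
  obtain ⟨ω, ⟨hω₁, hω₂⟩, hω₃, hω₄⟩ := ((h₁'.and h₂').and (h₃'.and h₄')).exists
  set ν : ℕ → Measure (SpinConfig (Site d)) := fun j => isingMeasure (zdGraph d) (Λ j) β h (.fixed ω) with hν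
  have hc : ∀ {p q : SpinConfig (Site d)},
      Tendsto (fun j => ∫ σ, (F p q).indicator (1 : SpinConfig (Site d) → ℝ) σ
        ∂(isingSpecification (zdGraph d) β h (Λ j) ω)) atTop (𝓝 (∫ σ, (F p q).indicator 1 σ ∂μ)) →
      Tendsto (fun j => ν j (F p q)) atTop (𝓝 (μ (F p q))) := fun {p q} ht =>
    tendsto_measure_of_tendsto_integral_indicator ν μ (hFm p q) ht
  have hfinμ : ∀ s : Set (SpinConfig (Site d)), μ s ≠ ∞ := fun s => measure_ne_top μ s
  refine le_of_tendsto_of_tendsto'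
    (ENNReal.Tendsto.mul (hc hω₁) (Or.inr (hfinμ _)) (hc hω₂) (Or.inr (hfinμ _)))
    (ENNReal.Tendsto.mul (hc hω₃) (Or.inr (hfinμ _)) (hc hω₄) (Or.inr (hfinμ _))) fun j => ?_
  have key := isBoxTP2_isingMeasure (zdGraph d) (Λ j) hβ h (.fixed ω) (J.piecewise a (-1)) (J.piecewise b 1)
    (J.piecewise a' (-1)) (J.piecewise b' 1)
  simp only [hν, hF, piecewise_inf, piecewise_sup]
  exact key

variable {n : ℕ}

/-- **Given `C_n`: every tail-trivial (extremal) Ising Gibbs state on `ℤ^d` (`d ≥ 1`, `β ≥ 0`, any `h`) satisfies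
`E_n(f_0,…,f_{n−1}) ≥ 0` for ALL measurable nonnegative increasing functionals of the infinite configuration.**
[this work] -/
theorem msahiE_nonneg_of_isTailTrivial [NeZero d] (hL : ∀ d', LiebSahiContinuum d' n) (hβ : 0 ≤ β)
    {μ : Measure (SpinConfig (Site d))} (hμ : μ ∈ isingGibbsMeasures d β h) (hμt : IsTailTrivial μ)
    (f : Fin n → SpinConfig (Site d) → ℝ) (hfm : ∀ i, Measurable (f i)) (hf0 : ∀ i σ, 0 ≤ f i σ)
    (hmono : ∀ i, Monotone (f i)) : 0 ≤ msahiE μ n f := by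
  have hμG : IsGibbsMeasure (isingSpecification (zdGraph d) β h) μ := hμ
  haveI := hμG.isProbabilityMeasure
  haveI : Infinite (Site d) := infinite_site_of_neZero
  exact msahiE_nonneg_of_isBoxTP2_spinConfig hL μ (isBoxTP2_of_isTailTrivial hβ hμ hμt) f hfm hf0 hmono

/-- Decreasing functionals. [this work] -/
theorem msahiE_nonneg_of_isTailTrivial_antitone [NeZero d] (hL : ∀ d', LiebSahiContinuum d' n) (hβ : 0 ≤ β)
    {μ : Measure (SpinConfig (Site d))} (hμ : μ ∈ isingGibbsMeasures d β h) (hμt : IsTailTrivial μ)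
    (f : Fin n → SpinConfig (Site d) → ℝ) (hfm : ∀ i, Measurable (f i)) (hf0 : ∀ i σ, 0 ≤ f i σ)
    (hanti : ∀ i, Antitone (f i)) : 0 ≤ msahiE μ n f := by
  have hμG : IsGibbsMeasure (isingSpecification (zdGraph d) β h) μ := hμ
  haveI := hμG.isProbabilityMeasure
  haveI : Infinite (Site d) := infinite_site_of_neZero
  exact msahiE_nonneg_of_isBoxTP2_spinConfig_antitone hL μ (isBoxTP2_of_isTailTrivial hβ hμ hμt) f hfm hf0 hanti

/-- From `C_n`. [this work; cite: Sahi2008, Conj. 5 (p. 212); LiebSahi2021, Conj. 1.1] -/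
theorem msahiE_nonneg_of_isTailTrivial_of_sahiConjecture [NeZero d] (hC : SahiConjecture n) (hβ : 0 ≤ β)
    {μ : Measure (SpinConfig (Site d))} (hμ : μ ∈ isingGibbsMeasures d β h) (hμt : IsTailTrivial μ)
    (f : Fin n → SpinConfig (Site d) → ℝ) (hfm : ∀ i, Measurable (f i)) (hf0 : ∀ i σ, 0 ≤ f i σ)
    (hmono : ∀ i, Monotone (f i)) : 0 ≤ msahiE μ n f :=
  msahiE_nonneg_of_isTailTrivial ((sahiConjecture_iff_forall_liebSahiContinuum n).1 hC) hβ hμ hμt f hfm hf0 hmono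

/-- **UNCONDITIONALLY: Sahi's Theorem 2 with two free local slots for every tail-trivial Ising Gibbs state**, every
`n` (`β ≥ 0`, any `h`, any `d`): local nonnegative increasing `f_i`, all but at most two of them indicators of
all-plus events. [this work] -/
theorem msahiE_nonneg_plusSpins_offTwo_of_isTailTrivial (hβ : 0 ≤ β) {μ : Measure (SpinConfig (Site d))}
    (hμ : μ ∈ isingGibbsMeasures d β h) (hμt : IsTailTrivial μ) (J : Finset (Site d))
    (f : Fin n → SpinConfig (Site d) → ℝ) (hdep : ∀ i, DependsOn (f i) (↑J : Set (Site d)))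
    (hf0 : ∀ i σ, 0 ≤ f i σ) (hmono : ∀ i, Monotone (f i)) (I : Finset (Fin n)) (hI : I.card ≤ 2)
    (A : Fin n → Finset (Site d))
    (hcum : ∀ i, i ∉ I → f i = {σ : SpinConfig (Site d) | ∀ v ∈ A i, σ v = 1}.indicator 1) :
    0 ≤ msahiE μ n f := by
  have hμG : IsGibbsMeasure (isingSpecification (zdGraph d) β h) μ := hμ
  haveI := hμG.isProbabilityMeasure
  exact msahiE_nonneg_offTwo_of_isBoxTP2_local μ (isBoxTP2_of_isTailTrivial hβ hμ hμt) J f hdep hf0 hmono I hI A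
    hcum

/-- **UNCONDITIONALLY, `n = 3` displayed, for every tail-trivial Ising Gibbs state**: `A` finite, `B, C` increasing
local events: `0 ≤ 2μ(P_A ∩ B ∩ C) + μ(P_A)μ(B)μ(C) − μ(P_A)μ(B ∩ C) − μ(B)μ(P_A ∩ C) − μ(C)μ(P_A ∩ B)`.
[this work] -/
theorem sahiE3_plusSpins_nonneg_of_isTailTrivial (hβ : 0 ≤ β) {μ : Measure (SpinConfig (Site d))}
    (hμ : μ ∈ isingGibbsMeasures d β h) (hμt : IsTailTrivial μ) (J A : Finset (Site d)) (hA : A ⊆ J)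
    {B C : Set (SpinConfig (Site d))} (hBm : MeasurableSet B) (hB : IsUpperSet B)
    (hBdep : DependsOn (fun σ => σ ∈ B) (↑J : Set (Site d))) (hCm : MeasurableSet C) (hC : IsUpperSet C)
    (hCdep : DependsOn (fun σ => σ ∈ C) (↑J : Set (Site d))) :
    0 ≤ sahiE3 μ {σ : SpinConfig (Site d) | ∀ v ∈ A, σ v = 1} B C := by
  have hμG : IsGibbsMeasure (isingSpecification (zdGraph d) β h) μ := hμ
  haveI := hμG.isProbabilityMeasure
  exact sahiE3_plusSpins_nonneg_of_isBoxTP2_local μ (isBoxTP2_of_isTailTrivial hβ hμ hμt) J A hA hBm hB hBdep hCm hC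
    hCdep

end TailTrivial

end Summit.CriticalPhenomena.PercolationContinuityZ3.Theorems.SahiBoxTP2
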